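import Summits.KontsevichZagierPeriods.KontsevichZagierPeriods.Theorems.LinRedNormalFormArrangementNormalFormStubRebaseSimplePosOneFibreCornerLocal

/-!
# Stub `stub_rebaseSimplePosOneZero` (crux `ArrangementNormalForm`, line `janus-bands`) —
part `CornerAssembly`: a normalised double-corner band is good

Corner toolkit for the double-corner bands at `B = 1`, sixth file: the LOCALISATION of a
double-corner band in normalised position (base pole `y = 0`, letter `0`, bounds `u < t < v` and
`y`-free apex level `κ = k x` through the origin, `u − κ = A (v − u)`, `A > 0`, `u` transverse,
base cell in the open quadrant with all rows non-negative at the origin, thick or far regime).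
Rule 1a throughout (`RebasePos.cutBase`): cut by `y = ε` and `x = ε` for the box of
`RebasePos.exists_box_eps` — the outer pieces have no corner on their closed cell (the only
corner is the origin: `RebasePos.good_noCorner_reg`) —, re-read the box piece with the cleaned
rows `RebasePos.boxM` (rows not through the origin are inactive), cut it by the diagonal `x = y`
and close the two sector pieces by `RebasePos.good_flatPiece` / `RebasePos.good_steepPiece`
(rule 2, the two blow-up charts). Result: `RebasePos.good_corner_norm`, registered as
`rebaseSimplePos_cornerNorm`.

References: M. Kontsevich, D. Zagier, *Periods* (2001), §1.2, rules (1a), (2).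
-/

noncomputable section

open Set MeasureTheory MvPolynomial
open Literature.NumberTheory.Transcendental Literature.ModelTheory.ExponentialFields

namespace Summit.KontsevichZagierPeriods.ArrangementNormalForm.JanusBands

namespace RebasePos

open SeparatePos

section Rows

variable {m' : ℕ}

/-- The row `ε − y > 0`. -/
def yTopRow (ε : ℚ) : (Fin (1 + 1) → ℚ) × ℚ := (![0, -1], ε)

/-- The row `ε − x > 0`. -/
def xTopRow (ε : ℚ) : (Fin (1 + 1) → ℚ) × ℚ := (![-1, 0], ε)

/-- The diagonal row `x − y > 0`. -/
def diagRow : (Fin (1 + 1) → ℚ) × ℚ := (![1, -1], 0)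

/-- The four rows of the box piece: `x > 0`, `y > 0`, `ε − x > 0`, `ε − y > 0`. -/
def boxK (ε : ℚ) : Fin 4 → (Fin (1 + 1) → ℚ) × ℚ :=
  ![(![1, 0], 0), (![0, 1], 0), (![-1, 0], ε), (![0, -1], ε)]

/-- `yTopRow` evaluated. -/
theorem affF_yTopRow (ε : ℚ) (z : Fin (1 + 1 + 1) → ℝ) : affF 1 1 (yTopRow ε) z = ε - z 1 := by
  rw [affF_two, yTopRow]; simp; ring

/-- `xTopRow` evaluated. -/
theorem affF_xTopRow (ε : ℚ) (z : Fin (1 + 1 + 1) → ℝ) : affF 1 1 (xTopRow ε) z = ε - z 0 := by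
  rw [affF_two, xTopRow]; simp; ring

/-- `diagRow` evaluated. -/
theorem affF_diagRow (z : Fin (1 + 1 + 1) → ℝ) : affF 1 1 diagRow z = z 0 - z 1 := by
  rw [affF_two, diagRow]; simp; ring

/-- The box rows evaluated. -/
theorem boxK_iff (ε : ℚ) (z : Fin (1 + 1 + 1) → ℝ) :
    (∀ k, 0 < affF 1 1 (boxK ε k) z) ↔ 0 < z 0 ∧ 0 < z 1 ∧ z 0 < ε ∧ z 1 < ε := by
  simp only [Fin.forall_fin_succ, IsEmpty.forall_iff, and_true]
  simp [boxK, affF_two]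

/-- The flat sector rows evaluated. -/
theorem boxRowsL_iff' (ε : ℚ) (z : Fin (1 + 1 + 1) → ℝ) :
    (∀ k, 0 < affF 1 1 (boxRowsL ε k) z) ↔ 0 < z 0 ∧ 0 < z 1 ∧ z 1 < z 0 ∧ z 0 < ε := by
  simp only [Fin.forall_fin_succ, IsEmpty.forall_iff, and_true]
  simp [boxRowsL, affF_two]

/-- The steep sector rows evaluated. -/
theorem boxRowsU_iff' (ε : ℚ) (z : Fin (1 + 1 + 1) → ℝ) :
    (∀ k, 0 < affF 1 1 (boxRowsU ε k) z) ↔ 0 < z 0 ∧ 0 < z 1 ∧ z 0 < z 1 ∧ z 1 < ε := by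
  simp only [Fin.forall_fin_succ, IsEmpty.forall_iff, and_true]
  simp [boxRowsU, affF_two]

/-- Rows of an appended family. -/
theorem rows_append_iff {k k' : ℕ} (N : Fin k → (Fin (1 + 1) → ℚ) × ℚ)
    (N' : Fin k' → (Fin (1 + 1) → ℚ) × ℚ) (z : Fin (1 + 1 + 1) → ℝ) :
    (∀ j, 0 < affF 1 1 (Fin.append N N' j) z) ↔ (∀ j, 0 < affF 1 1 (N j) z) ∧ ∀ j, 0 < affF 1 1 (N' j) z := by
  rw [Fin.forall_fin_add]
  simp only [Fin.append_left, Fin.append_right]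

/-- Rows of an extended family. -/
theorem rows_snoc_iff {M : Fin m' → (Fin (1 + 1) → ℚ) × ℚ} {h : (Fin (1 + 1) → ℚ) × ℚ}
    {z : Fin (1 + 1 + 1) → ℝ} :
    (∀ j, 0 < affF 1 1 ((Fin.snoc M h : Fin (m' + 1) → _) j) z) ↔
      (∀ j, 0 < affF 1 1 (M j) z) ∧ 0 < affF 1 1 h z := by
  simp only [Fin.forall_fin_succ', Fin.snoc_castSucc, Fin.snoc_last]

/-- Two row families with the same positivity sets define the same literal domain. -/
theorem gDom_congr_rows {k k' : ℕ} (N : Fin k → (Fin (1 + 1) → ℚ) × ℚ)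
    (N' : Fin k' → (Fin (1 + 1) → ℚ) × ℚ) (U V : (Fin (1 + 1) → ℚ) × ℚ)
    (h : ∀ z : Fin (1 + 1 + 1) → ℝ, (∀ j, 0 < affF 1 1 (N j) z) ↔ ∀ j, 0 < affF 1 1 (N' j) z) :
    gDom 1 1 k N (fun _ => Sum.inr U) (fun _ => Sum.inr V) =
      gDom 1 1 k' N' (fun _ => Sum.inr U) (fun _ => Sum.inr V) := by
  ext z
  rw [mem_gDom_one, mem_gDom_one, h]

end Rows

section CornerNorm

variable {m m' : ℕ}

/-- At a corner point of a normalised band both base coordinates vanish. -/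
theorem corner_xy {u κ : (Fin (1 + 1) → ℚ) × ℚ} (hκy : κ.1 1 = 0) (hκ0 : κ.2 = 0) (hk : κ.1 0 ≠ 0)
    (hu0 : u.2 = 0) (huy : u.1 1 ≠ 0) {z : Fin (1 + 1 + 1) → ℝ} (hκz : affF 1 1 κ z = 0)
    (huz : affF 1 1 u z = 0) : z 0 = 0 ∧ z 1 = 0 := by
  have h1 : (κ.1 0 : ℝ) * z 0 = 0 := by
    rw [affF_two, hκy, hκ0] at hκz
    simpa using hκz
  have hx : z 0 = 0 := (mul_eq_zero.1 h1).resolve_left (by exact_mod_cast hk)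
  have h2 : (u.1 1 : ℝ) * z 1 = 0 := by
    rw [affF_two, hu0, hx] at huz
    simpa using huz
  exact ⟨hx, (mul_eq_zero.1 h2).resolve_left (by exact_mod_cast huy)⟩

variable (L : Fin m → (Fin 1 → ℚ) × ℚ) (e : Fin m → ℕ) (ℓ₁ : (Fin 1 → ℚ) × ℚ)

/-- **A normalised double-corner band is good.** See the module docstring. -/
theorem good_corner_norm (far : Bool) (s : KZ.IntegralRep (1 + 1 + 1)) (M : Fin m' → (Fin (1 + 1) → ℚ) × ℚ)
    (p : MvPolynomial (Fin 1) ℚ) (u v κ : (Fin (1 + 1) → ℚ) × ℚ) (A : ℚ)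
    (hbd : Bornology.IsBounded s.domain)
    (hdom : s.domain = gDom 1 1 m' M (fun _ => Sum.inr u) (fun _ => Sum.inr v))
    (hint : EqOn s.integrand (glit 1 1 p L e ℓ₁ 0 0 1 (fun _ => some 0)) s.domain)
    (hu0 : u.2 = 0) (hv0 : v.2 = 0) (hκ0 : κ.2 = 0) (hκy : κ.1 1 = 0) (huy : u.1 1 ≠ 0)
    (hA : u - κ = A • (v - u)) (hA0 : 0 < A)
    (hcell : ∀ z : Fin (1 + 1 + 1) → ℝ, (∀ j, 0 < affF 1 1 (M j) z) →
      bif far then (0 < affF 1 1 κ z ∧ affF 1 1 u z < affF 1 1 v z ∧ 2 * affF 1 1 κ z ≤ affF 1 1 v z)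
      else (affF 1 1 κ z < 0 ∧ 0 < affF 1 1 u z ∧ affF 1 1 u z < affF 1 1 v z))
    (hx : ∀ z : Fin (1 + 1 + 1) → ℝ, (∀ j, 0 < affF 1 1 (M j) z) → 0 < z 0)
    (hy : ∀ z : Fin (1 + 1 + 1) → ℝ, (∀ j, 0 < affF 1 1 (M j) z) → 0 < z 1)
    (hM0 : ∀ j, 0 ≤ (M j).2) :
    ∃ c ∈ AddSubgroup.closure (GGset 1 2 1), KZ.of s - c ∈ KZ.relations := by
  -- an empty cell is trivial
  by_cases hne : ∃ z₀ : Fin (1 + 1 + 1) → ℝ, ∀ j, 0 < affF 1 1 (M j) z₀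
  swap
  · push Not at hne
    refine good_of_null s ?_
    have he : s.domain = ∅ := by
      rw [hdom]
      exact Set.eq_empty_iff_forall_notMem.2 fun z hz => by
        rw [mem_gDom_one] at hz
        obtain ⟨j, hj⟩ := hne z
        exact absurd (hz.1 j) (not_lt.2 hj)
    rw [he, measure_empty]
  obtain ⟨z₀, hz₀⟩ := hne
  have hk : κ.1 0 ≠ 0 := by
    intro hk
    have h := reg_ne far (hcell z₀ hz₀)
    rw [affF_two, hk, hκy, hκ0] at h
    simp at h
  have hε' : ∀ {ε : ℚ}, 0 < ε → (0 : ℝ) < ε := fun h => by exact_mod_cast h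
  obtain ⟨ε, hε, hεM⟩ := exists_box_eps M hM0
  -- sub-cells whose closed base cell avoids the origin have no corner
  have hout : ∀ (k : ℕ) (s' : KZ.IntegralRep (1 + 1 + 1)) (N : Fin k → (Fin (1 + 1) → ℚ) × ℚ),
      s'.domain ⊆ s.domain → s'.domain = gDom 1 1 k N (fun _ => Sum.inr u) (fun _ => Sum.inr v) →
      s'.integrand = s.integrand →
      (∀ z : Fin (1 + 1 + 1) → ℝ, (∀ j, 0 < affF 1 1 (N j) z) → ∀ j, 0 < affF 1 1 (M j) z) →
      (∀ z ∈ closure {z : Fin (1 + 1 + 1) → ℝ | ∀ j, 0 < affF 1 1 (N j) z}, z 0 = 0 → z 1 = 0 → False) →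
      ∃ c ∈ AddSubgroup.closure (GGset 1 2 1), KZ.of s' - c ∈ KZ.relations := by
    intro k s' N hsub hd' hi' hrows havoid
    exact good_noCorner_reg L e ℓ₁ 0 0 1 far s' N p u v κ A (Or.inl rfl) (hbd.subset hsub) hd'
      (by rw [hi']; exact hint.mono hsub) hA hA0 (fun z hz => hcell z (hrows z hz)) fun z hz hκz huz _ => by
        obtain ⟨h0, h1⟩ := corner_xy hκy hκ0 hk hu0 huy hκz huz
        exact havoid z hz h0 h1
  -- (1) cut by `y = ε`
  have hyT : yTopRow ε ≠ 0 := fun h => by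
    have := congrArg Prod.snd h
    simp only [yTopRow, Prod.snd_zero] at this
    exact hε.ne' this
  obtain ⟨s₁, s₂, hm₁, hm₂, hi₁, hi₂, hd₁, hd₂, hrel⟩ := cutBase s M _ _ hdom (yTopRow ε) hyT
  have hsub₁ : s₁.domain ⊆ s.domain := fun z hz => ((hm₁ z).1 hz).1
  have hsub₂ : s₂.domain ⊆ s.domain := fun z hz => ((hm₂ z).1 hz).1
  refine good_of_split hrel ?_ (hout _ s₂ _ hsub₂ hd₂ hi₂ (fun z hz => (rows_snoc hz).1) fun z hz _ h1 => ?_)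
  swap
  · have hle := le_of_closure_rows (M := Fin.snoc M (-yTopRow ε)) (f := fun _ => (ε : ℝ))
      (g := fun z => z 1) continuous_const (continuous_apply 1)
      (fun z hz => by have h := (rows_snoc hz).2; rw [affF_neg', affF_yTopRow] at h; linarith) z hz
    simp only [h1] at hle
    linarith [hε' hε]
  -- (2) cut by `x = ε`
  have hxT : xTopRow ε ≠ 0 := fun h => by
    have := congrArg Prod.snd h
    simp only [xTopRow, Prod.snd_zero] at this
    exact hε.ne' this
  obtain ⟨s₃, s₄, hm₃, hm₄, hi₃, hi₄, hd₃, hd₄, hrel'⟩ :=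
    cutBase s₁ (Fin.snoc M (yTopRow ε)) _ _ hd₁ (xTopRow ε) hxT
  have hsub₃ : s₃.domain ⊆ s.domain := fun z hz => hsub₁ ((hm₃ z).1 hz).1
  have hsub₄ : s₄.domain ⊆ s.domain := fun z hz => hsub₁ ((hm₄ z).1 hz).1
  refine good_of_split hrel' ?_ (hout _ s₄ _ hsub₄ hd₄ (by rw [hi₄, hi₁])
    (fun z hz => (rows_snoc (rows_snoc hz).1).1) fun z hz h0 _ => ?_)
  swap
  · have hle := le_of_closure_rows (M := Fin.snoc (Fin.snoc M (yTopRow ε) : Fin (m' + 1) → _) (-xTopRow ε))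
      (f := fun _ => (ε : ℝ)) (g := fun z => z 0) continuous_const (continuous_apply 0)
      (fun z hz => by have h := (rows_snoc hz).2; rw [affF_neg', affF_xTopRow] at h; linarith) z hz
    simp only [h0] at hle
    linarith [hε' hε]
  -- (3) the box piece, re-read with the cleaned rows
  have hK : ∀ z : Fin (1 + 1 + 1) → ℝ,
      (∀ j, 0 < affF 1 1 ((Fin.snoc (Fin.snoc M (yTopRow ε) : Fin (m' + 1) → _) (xTopRow ε) :
        Fin (m' + 1 + 1) → _) j) z) ↔ ∀ j, 0 < affF 1 1 (Fin.append (boxM M) (boxK ε) j) z := by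
    intro z
    rw [rows_snoc_iff, rows_snoc_iff, rows_append_iff, boxK_iff, affF_yTopRow, affF_xTopRow]
    constructor
    · rintro ⟨⟨hM, hyε⟩, hxε⟩
      have hx0 := hx z hM
      have hy0 := hy z hM
      exact ⟨(boxM_iff M ε hεM z hx0 (by linarith) hy0 (by linarith)).2 hM, hx0, hy0, by linarith,
        by linarith⟩
    · rintro ⟨hMb, hx0, hy0, hxε, hyε⟩
      exact ⟨⟨(boxM_iff M ε hεM z hx0 hxε hy0 hyε).1 hMb, by linarith⟩, by linarith⟩
  have hd₃' : s₃.domain = gDom 1 1 (m' + 4) (Fin.append (boxM M) (boxK ε)) (fun _ => Sum.inr u)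
      (fun _ => Sum.inr v) := by
    rw [hd₃]
    exact gDom_congr_rows _ _ u v hK
  have hrows₃ : ∀ z : Fin (1 + 1 + 1) → ℝ, (∀ j, 0 < affF 1 1 (Fin.append (boxM M) (boxK ε) j) z) →
      ∀ j, 0 < affF 1 1 (M j) z := fun z hz => (rows_snoc (rows_snoc ((hK z).2 hz)).1).1
  -- (4) cut the box piece by the diagonal
  have hdg : diagRow ≠ 0 := fun h => by
    have := congrArg (fun q : (Fin (1 + 1) → ℚ) × ℚ => q.1 0) h
    simp [diagRow] at this
  obtain ⟨s₅, s₆, hm₅, hm₆, hi₅, hi₆, hd₅, hd₆, hrel''⟩ :=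
    cutBase s₃ (Fin.append (boxM M) (boxK ε)) _ _ hd₃' diagRow hdg
  have hsub₅ : s₅.domain ⊆ s.domain := fun z hz => hsub₃ ((hm₅ z).1 hz).1
  have hsub₆ : s₆.domain ⊆ s.domain := fun z hz => hsub₃ ((hm₆ z).1 hz).1
  have h5 : ∀ z : Fin (1 + 1 + 1) → ℝ,
      (∀ j, 0 < affF 1 1 ((Fin.snoc (Fin.append (boxM M) (boxK ε)) diagRow : Fin (m' + 4 + 1) → _) j) z) ↔
        ∀ j, 0 < affF 1 1 (Fin.append (boxM M) (boxRowsL ε) j) z := fun z => by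
    rw [rows_snoc_iff, rows_append_iff, rows_append_iff, boxK_iff, boxRowsL_iff', affF_diagRow]
    constructor
    · rintro ⟨⟨hMb, hx0, hy0, hxε, -⟩, hd⟩
      exact ⟨hMb, hx0, hy0, by linarith, hxε⟩
    · rintro ⟨hMb, hx0, hy0, hyx, hxε⟩
      exact ⟨⟨hMb, hx0, hy0, hxε, by linarith⟩, by linarith⟩
  have h6 : ∀ z : Fin (1 + 1 + 1) → ℝ,
      (∀ j, 0 < affF 1 1 ((Fin.snoc (Fin.append (boxM M) (boxK ε)) (-diagRow) : Fin (m' + 4 + 1) → _) j) z) ↔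
        ∀ j, 0 < affF 1 1 (Fin.append (boxM M) (boxRowsU ε) j) z := fun z => by
    rw [rows_snoc_iff, rows_append_iff, rows_append_iff, boxK_iff, boxRowsU_iff', affF_neg', affF_diagRow]
    constructor
    · rintro ⟨⟨hMb, hx0, hy0, -, hyε⟩, hd⟩
      exact ⟨hMb, hx0, hy0, by linarith, hyε⟩
    · rintro ⟨hMb, hx0, hy0, hxy, hyε⟩
      exact ⟨⟨hMb, hx0, hy0, by linarith, hyε⟩, by linarith⟩
  refine good_of_split hrel'' ?_ ?_
  · exact good_flatPiece L e ℓ₁ far ε s₅ (boxM M) p u v κ A (by rw [hd₅]; exact gDom_congr_rows _ _ u v h5)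
      (by rw [hi₅, hi₃, hi₁]; exact hint.mono hsub₅) (boxM_origin M) hu0 hv0 hκ0 hκy hA hA0
      fun z hz => hcell z (hrows₃ z (rows_snoc ((h5 z).2 hz)).1)
  · exact good_steepPiece L e ℓ₁ far ε s₆ (boxM M) p u v κ A (by rw [hd₆]; exact gDom_congr_rows _ _ u v h6)
      (by rw [hi₆, hi₃, hi₁]; exact hint.mono hsub₆) (boxM_origin M) hu0 hv0 hA hA0
      fun z hz => hcell z (hrows₃ z (rows_snoc ((h6 z).2 hz)).1)

end CornerNorm

end RebasePos

/-- **Registered part of `stub_rebaseSimplePosOneZero` (line `janus-bands`): a normalised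
double-corner band is good** (`RebasePos.good_corner_norm`): a literal one-fibre datum over the
base `(x, y)` with base pole `y = 0`, letter `0`, bounds `u < t < v` and `y`-free apex level `κ`
all through the origin, `u − κ = A (v − u)`, `A > 0`, `u` transverse, base cell in the open
quadrant with rows non-negative at the origin, in the thick (`far = false`) or the far
(`far = true`) regime, is congruent modulo `KZ.relations` to the subgroup generated by
`GG 1 2 1` (localisation by rule 1a, the two blow-up charts by rule 2). -/
theorem rebaseSimplePos_cornerNorm (m m' : ℕ) (L : Fin m → (Fin 1 → ℚ) × ℚ) (e : Fin m → ℕ) (ℓ₁ : (Fin 1 → ℚ) × ℚ) (far : Bool) (s : KZ.IntegralRep (1 + 1 + 1)) (M : Fin m' → (Fin (1 + 1) → ℚ) × ℚ) (p : MvPolynomial (Fin 1) ℚ) (u v κ : (Fin (1 + 1) → ℚ) × ℚ) (A : ℚ) (hbd : Bornology.IsBounded s.domain) (hdom : s.domain = SeparatePos.gDom 1 1 m' M (fun _ => Sum.inr u) (fun _ => Sum.inr v)) (hint : EqOn s.integrand (RebasePos.glit 1 1 p L e ℓ₁ 0 0 1 (fun _ => some 0)) s.domain) (hu0 : u.2 =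 0) (hv0 : v.2 = 0) (hκ0 : κ.2 = 0) (hκy : κ.1 1 = 0) (huy : u.1 1 ≠ 0) (hA : u - κ = A • (v - u)) (hA0 : 0 < A) (hcell : ∀ z : Fin (1 + 1 + 1) → ℝ, (∀ j, 0 < SeparatePos.affF 1 1 (M j) z) → bif far then (0 < SeparatePos.affF 1 1 κ z ∧ SeparatePos.affF 1 1 u z < SeparatePos.affF 1 1 v z ∧ 2 * SeparatePos.affF 1 1 κ z ≤ SeparatePos.affF 1 1 v z) else (SeparatePos.affF 1 1 κ z < 0 ∧ 0 < SeparatePos.affF 1 1 u z ∧ SeparatePos.affF 1 1 u z < SeparatePos.affF 1 1 v z)) (hx : ∀ z : Fin (1 + 1 + 1) → ℝ, (∀ j, 0 < SeparatePos.affF 1 1 (M j) z) → 0 < z 0) (hy : ∀ z : Fin (1 + 1 + 1) → ℝ, (∀ j, 0 < SeparatePos.affF 1 1 (M j) z) → 0 < z 1) (hM0 : ∀ j, 0 ≤ (M j).2) : ∃ c ∈ AddSubgroup.closure (SeparatePos.GGset 1 2 1), KZ.of s - c ∈ KZ.relations :=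
  RebasePos.good_corner_norm L e ℓ₁ far s M p u v κ A hbd hdom hint hu0 hv0 hκ0 hκy huy hA hA0 hcell hx hy hM0

end Summit.KontsevichZagierPeriods.ArrangementNormalForm.JanusBands
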